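import Literature.Probability.RandomPlanarGeometry.HexParafermion
import Literature.Probability.RandomPlanarGeometry.HexSAW
import Literature.Probability.LatticeModels.TriangularLatticeProofs
import Literature.Barriers.CriticalPhenomena.ParafermionicHalfCauchyRiemann
import HarnessLib

/-!
# Route `SAWDefectDecoherence`, crux `BoundaryClosureR` (stmt-CriticalPhenomena-14004), line
`pick-half-plane`: vocabulary of the developing-map / hull lemmas

Definitions file (reviewed) for the objects the line `pick-half-plane` posits and its helper
files (`…BoundaryClosureRHullMinPrinciple.lean`, the gate-anchor file) and skeleton
(`Cruxes/BoundaryClosureR/Lines/pick_half_plane.lean`) use: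

* `IsPotential Λ a H` — `H : Site 2 → ℂ` is a developing map of `F dz` (verbatim the body of the
  pool item `SAWDevelopingMap.PotentialExists`, stmt-8299: across every `𝕋`-edge `s → t` dual to
  a hexagonal edge `{v, w}`, `v ∈ Λ`, with the centre of `v` on the LEFT,
  `H t − H s = (mid{v,w} − c_v)·F_{x_c,5/8}({v,w})`);
* floor cells: `upFace k m = (![k,m],0)`, `belowFace k m = (![k,m−1],1)` (directly below),
  `floorEdge k m = s(belowFace, upFace)` (a vertical dangling edge), `IsFlatFloor Λ m k₁ k₂`;
* sites: `siteNbrs s` (the six `𝕋`-neighbours), `IsInteriorSite Λ s` (all faces at `s` lie in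
  `Λ`: a full hexagon), `IsLatticeSite Λ s` (a vertex of a face of `Λ`), `spoke s k` (the
  neighbour across the `k`-th edge `HexKernel.edge s k` of the hexagon `HexKernel.face s ·`);
* `edgeValue F s k = (mid(edge_k) − c(face_{k+1}))·F(edge_k)`, the `k`-th rotated edge value.

Proved here (all elementary): incidence lemmas; `potential_spoke` (the six increments of a
potential around an interior site ARE the rotated edge values); the DISCRETE MINIMUM PRINCIPLE
`exists_boundarySite_re_le` (if at every interior site the six increments lie in no closed
half-plane — the strict hexagon hull condition — then every linear functional `Re(conj d · H)` is
minimised over the sites of `Λ` at a boundary site) and its edge-value form; the FLUX POLYGON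
`edgeValue_succ_sub` (consecutive rotated edge values differ by the radial vertex-relation term)
with the closedness corollary `sum_radial_term_eq_zero`.  No statement of the crux is restated;
the hull condition itself (an open lattice inequality, crux-level claim of the card
`hexagon-hull-tutte-engine` of crux stmt-8296) appears only as a HYPOTHESIS.
-/

noncomputable section

open Literature.Probability.LatticeModels Literature.Probability.RandomPlanarGeometry
open Literature.Probability.RandomPlanarGeometry.SAW
open Literature.Barriers.CriticalPhenomena

namespace Summit.CriticalPhenomena.SAWScalingLimit.Theorems.PickHalfPlane

/-! ### The developing map -/

/-- `H : Site 2 → ℂ` is a POTENTIAL (developing map) of `F dz` for the domain `Λ` rooted at `a`: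
along every triangular-lattice edge `s → t` dual to a hexagonal edge `{v, w}` (`v ∈ Λ`) and
oriented with the centre of `v` on its LEFT, `H t − H s = (mid{v,w} − c_v)·F_{x_c,5/8}({v,w})`.
(Verbatim the body of the pool item `SAWDevelopingMap.PotentialExists`, stmt-8299.)
[cite: DuminilCopinSmirnov2012, §4 (the map H with dH = F dz, "Conformal invariance" discussion)] -/
def IsPotential (Λ : Finset HexVertex) (a : Sym2 HexVertex) (H : Site 2 → ℂ) : Prop :=
  ∀ v ∈ Λ, ∀ w : HexVertex, hexGraph.Adj v w → ∀ s t : Site 2,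
    s ∈ hexFaceVertices v → t ∈ hexFaceVertices v → s ∈ hexFaceVertices w → t ∈ hexFaceVertices w →
    s ≠ t → 0 < ((starRingEnd ℂ) (triEmbed t - triEmbed s) * (hexCenter v - triEmbed s)).im →
    H t - H s = (hexMidpoint s(v, w) - hexCenter v) *
      hexParafermionicObservable Λ a hexCriticalFugacity (5 / 8) s(v, w)

/-! ### Flat floors -/

/-- The up-face of the cell `(k, m)` (row `m` = second lattice coordinate). [folklore] -/
def upFace (k m : ℤ) : HexVertex := (![k, m], 0)

/-- The down-face hanging directly BELOW `upFace k m` (centres differ by `i/√3`). [folklore] -/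
def belowFace (k m : ℤ) : HexVertex := (![k, m - 1], 1)

/-- The vertical DANGLING edge under the cell `(k, m)`, written `s(outside, inside)`; its
midpoint lies on the floor line `im z = m √3/2`. [folklore] -/
def floorEdge (k m : ℤ) : Sym2 HexVertex := s(belowFace k m, upFace k m)

/-- Row `m` of `Λ` is an exact FLAT FLOOR over the columns `k₁ ≤ k ≤ k₂`: up-faces in `Λ`, the
faces below them not in `Λ`, the down-faces of the row between consecutive up-faces in `Λ`.
[folklore] -/
def IsFlatFloor (Λ : Finset HexVertex) (m k₁ k₂ : ℤ) : Prop :=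
  ∀ k : ℤ, k₁ ≤ k → k ≤ k₂ →
    upFace k m ∈ Λ ∧ belowFace k m ∉ Λ ∧ (k < k₂ → ((![k, m], 1) : HexVertex) ∈ Λ)

/-- The half-edge vector of a floor edge: `mid(floorEdge k m) − c(upFace k m) = (1 − 2ζ)/6 = −i/(2√3)`.
[folklore] -/
theorem hexMidpoint_floorEdge_sub (k m : ℤ) :
    hexMidpoint (floorEdge k m) - hexCenter (upFace k m) = (1 - 2 * triZeta) / 6 := by
  unfold floorEdge belowFace upFace
  rw [hexMidpoint_mk]
  simp only [hexCenter, triEmbed, Matrix.cons_val_zero, Matrix.cons_val_one,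
    Fin.val_one, Fin.val_zero, Nat.cast_one, Nat.cast_zero, Int.cast_sub, Int.cast_one]
  ring

/-- The floor half-edge vector is purely imaginary. [folklore] -/
theorem re_hexMidpoint_floorEdge_sub (k m : ℤ) :
    (hexMidpoint (floorEdge k m) - hexCenter (upFace k m)).re = 0 := by
  rw [hexMidpoint_floorEdge_sub]
  simp [Literature.Probability.LatticeModels.triZeta_re]

/-- The face below is adjacent to the up-face (`(x,0) ∼ (x − e₁, 1)`). [folklore] -/
theorem adj_belowFace_upFace (k m : ℤ) : hexGraph.Adj (belowFace k m) (upFace k m) := by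
  rw [hexGraph.adj_comm]
  unfold upFace belowFace
  rw [Literature.Probability.LatticeModels.hexGraph_adj_iff_of_snd_eq_zero_holds]
  refine Or.inr (Or.inr ?_)
  ext i
  fin_cases i <;> simp [sub_eq_add_neg]

/-! ### Sites around a full hexagon -/

/-- The six `𝕋`-neighbours of a site. [folklore] -/
def siteNbrs (s : Site 2) : Finset (Site 2) :=
  {s + Pi.single 0 1, s - Pi.single 0 1, s + Pi.single 1 1, s - Pi.single 1 1, s + triDiag, s - triDiag}

/-- A site is INTERIOR for `Λ` if every face (triangle) containing it belongs to `Λ` (a full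
hexagon of `Λ` around the site). [folklore] -/
def IsInteriorSite (Λ : Finset HexVertex) (s : Site 2) : Prop :=
  ∀ f : HexVertex, s ∈ hexFaceVertices f → f ∈ Λ

/-- A site of `Λ`: a vertex of some face of `Λ` (where potentials of `Λ` are evaluated). [folklore] -/
def IsLatticeSite (Λ : Finset HexVertex) (s : Site 2) : Prop :=
  ∃ f ∈ Λ, s ∈ hexFaceVertices f

/-- The `𝕋`-neighbour of `s` across the `k`-th edge of the hexagon `HexKernel.face s ·` around `s`
(spoke direction `60° + 60°·k`): `s+e₁, s−e₀+e₁, s−e₀, s−e₁, s+e₀−e₁, s+e₀`. [folklore] -/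
def spoke (s : Site 2) : Fin 6 → Site 2 :=
  ![s + Pi.single 1 1, s - triDiag, s - Pi.single 0 1, s - Pi.single 1 1, s + triDiag,
    s + Pi.single 0 1]

/-- The `k`-th ROTATED EDGE VALUE of a mid-edge function `F` around the hexagon at `s`:
`(mid(edge_k) − c(face_{k+1}))·F(edge_k)`. [folklore] -/
def edgeValue (F : Sym2 HexVertex → ℂ) (s : Site 2) (k : Fin 6) : ℂ :=
  (hexMidpoint (HexKernel.edge s k) - hexCenter (HexKernel.face s (k + 1))) * F (HexKernel.edge s k)

/-- A `𝕋`-neighbour of an interior site of `Λ` is a site of `Λ` (it shares with `s` one of the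
three up-faces `(s,0)`, `(s − e₀, 0)`, `(s − e₁, 0)`, all of which contain `s`). [folklore] -/
theorem isLatticeSite_of_mem_siteNbrs {Λ : Finset HexVertex} {s t : Site 2}
    (hs : IsInteriorSite Λ s) (ht : t ∈ siteNbrs s) : IsLatticeSite Λ t := by
  have h0 : s ∈ hexFaceVertices ((s, 0) : HexVertex) := by
    rw [mem_hexFaceVertices_zero]; exact Or.inl rfl
  have h1 : s ∈ hexFaceVertices ((s - Pi.single 0 1, 0) : HexVertex) := by
    rw [mem_hexFaceVertices_zero]; exact Or.inr (Or.inl (by rw [sub_add_cancel]))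
  have h2 : s ∈ hexFaceVertices ((s - Pi.single 1 1, 0) : HexVertex) := by
    rw [mem_hexFaceVertices_zero]; exact Or.inr (Or.inr (by rw [sub_add_cancel]))
  simp only [siteNbrs, Finset.mem_insert, Finset.mem_singleton] at ht
  rcases ht with rfl | rfl | rfl | rfl | rfl | rfl
  · exact ⟨_, hs _ h0, by rw [mem_hexFaceVertices_zero]; exact Or.inr (Or.inl rfl)⟩
  · exact ⟨_, hs _ h1, by rw [mem_hexFaceVertices_zero]; exact Or.inl rfl⟩
  · exact ⟨_, hs _ h0, by rw [mem_hexFaceVertices_zero]; exact Or.inr (Or.inr rfl)⟩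
  · exact ⟨_, hs _ h2, by rw [mem_hexFaceVertices_zero]; exact Or.inl rfl⟩
  · refine ⟨_, hs _ h2, ?_⟩
    rw [mem_hexFaceVertices_zero]
    refine Or.inr (Or.inl ?_)
    ext i; fin_cases i <;> simp [triDiag]; ring
  · refine ⟨_, hs _ h1, ?_⟩
    rw [mem_hexFaceVertices_zero]
    refine Or.inr (Or.inr ?_)
    ext i; fin_cases i <;> simp [triDiag]

/-- The spokes enumerate `siteNbrs`. [folklore] -/
theorem spoke_mem_siteNbrs (s : Site 2) (k : Fin 6) : spoke s k ∈ siteNbrs s := by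
  fin_cases k <;> simp [spoke, siteNbrs]

/-- Every neighbour is a spoke. [folklore] -/
theorem exists_spoke_eq_of_mem_siteNbrs {s t : Site 2} (ht : t ∈ siteNbrs s) :
    ∃ k, spoke s k = t := by
  simp only [siteNbrs, Finset.mem_insert, Finset.mem_singleton] at ht
  rcases ht with rfl | rfl | rfl | rfl | rfl | rfl
  · exact ⟨5, rfl⟩
  · exact ⟨2, rfl⟩
  · exact ⟨0, rfl⟩
  · exact ⟨3, rfl⟩
  · exact ⟨4, rfl⟩
  · exact ⟨1, rfl⟩

/-- `s` is a vertex of each of the six faces around it. [folklore] -/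
theorem mem_hexFaceVertices_face (s : Site 2) (j : Fin 6) :
    s ∈ hexFaceVertices (HexKernel.face s j) := by
  fin_cases j <;>
    simp [HexKernel.face, HexKernel.mem_hexFaceVertices_up_iff,
      HexKernel.mem_hexFaceVertices_down_iff]

/-- An interior site is a lattice site. [folklore] -/
theorem IsInteriorSite.isLatticeSite {Λ : Finset HexVertex} {s : Site 2} (hs : IsInteriorSite Λ s) :
    IsLatticeSite Λ s :=
  ⟨_, hs _ (mem_hexFaceVertices_face s 0), mem_hexFaceVertices_face s 0⟩

/-- The spoke endpoint is a vertex of the face to its left … [folklore] -/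
theorem spoke_mem_hexFaceVertices_face_succ (s : Site 2) (k : Fin 6) :
    spoke s k ∈ hexFaceVertices (HexKernel.face s (k + 1)) := by
  fin_cases k <;>
    (simp [HexKernel.face, spoke, HexKernel.mem_hexFaceVertices_up_iff,
      HexKernel.mem_hexFaceVertices_down_iff, Pi.add_apply, Pi.sub_apply]; try ring_nf)

/-- … and of the face to its right. [folklore] -/
theorem spoke_mem_hexFaceVertices_face (s : Site 2) (k : Fin 6) :
    spoke s k ∈ hexFaceVertices (HexKernel.face s k) := by
  fin_cases k <;>
    (simp [HexKernel.face, spoke, HexKernel.mem_hexFaceVertices_up_iff,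
      HexKernel.mem_hexFaceVertices_down_iff, Pi.add_apply, Pi.sub_apply]; try ring_nf)

/-- A spoke is a nonzero step. [folklore] -/
theorem spoke_ne (s : Site 2) (k : Fin 6) : s ≠ spoke s k := by
  intro h
  fin_cases k <;>
    · have h0 := congrFun h 0
      have h1 := congrFun h 1
      simp [spoke, Pi.add_apply, Pi.sub_apply] at h0 h1
      all_goals omega

/-- The face `HexKernel.face s (k+1)` lies to the LEFT of the `k`-th spoke (orientation clause of
`IsPotential`). [folklore] -/
theorem spoke_orientation (s : Site 2) (k : Fin 6) :
    0 < ((starRingEnd ℂ) (triEmbed (spoke s k) - triEmbed s) *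
      (hexCenter (HexKernel.face s (k + 1)) - triEmbed s)).im := by
  have h3 : (0 : ℝ) < Real.sqrt 3 := Real.sqrt_pos.2 (by norm_num)
  fin_cases k <;>
    · simp only [spoke, HexKernel.face, Fin.reduceFinMk, Fin.isValue, Matrix.cons_val,
        Matrix.cons_val_zero, Matrix.cons_val_one, HexKernel.hexCenter_mk, triEmbed_add,
        Literature.Probability.LatticeModels.triEmbed_sub, triEmbed_single_zero,
        triEmbed_single_one, Fin.reduceAdd]
      simp [Complex.mul_im, triEmbed, Literature.Probability.LatticeModels.triZeta_re,
        Literature.Probability.LatticeModels.triZeta_im] <;>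
      nlinarith [Real.sq_sqrt (show (0 : ℝ) ≤ 3 by norm_num)]

/-! ### The six increments of a potential around an interior site -/

/-- **The six increments of a potential around an interior site are the rotated edge values**:
across the `k`-th spoke the increment is `edgeValue F s k = (mid(edge_k) − c(face_{k+1}))·F(edge_k)`,
`F` the critical observable. [folklore] -/
theorem potential_spoke {Λ : Finset HexVertex} {a : Sym2 HexVertex} {H : Site 2 → ℂ}
    (hH : IsPotential Λ a H) {s : Site 2} (hs : IsInteriorSite Λ s) (k : Fin 6) :
    H (spoke s k) - H s =
      edgeValue (hexParafermionicObservable Λ a hexCriticalFugacity (5 / 8)) s k := by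
  have hadj : hexGraph.Adj (HexKernel.face s (k + 1)) (HexKernel.face s k) :=
    (HexKernel.adj_face_iff HexKernel.hexGraph_adj_iff_of_snd_eq_zero_holds
      HexKernel.not_hexGraph_adj_of_snd_eq_holds s k _).2 (Or.inl rfl)
  have hv : HexKernel.face s (k + 1) ∈ Λ := hs _ (mem_hexFaceVertices_face s (k + 1))
  have hswap : HexKernel.edge s k = s(HexKernel.face s (k + 1), HexKernel.face s k) := by
    rw [HexKernel.edge, Sym2.eq_swap]
  rw [edgeValue, hswap]
  exact hH (HexKernel.face s (k + 1)) hv (HexKernel.face s k) hadj s (spoke s k)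
    (mem_hexFaceVertices_face s (k + 1)) (spoke_mem_hexFaceVertices_face_succ s k)
    (mem_hexFaceVertices_face s k) (spoke_mem_hexFaceVertices_face s k) (spoke_ne s k)
    (spoke_orientation s k)

/-- The strict hull condition at an interior site, stated on the potential (some neighbour
increment has positive real part against every `conj d`) and stated on the six rotated edge
values of the observable, are the same condition. [folklore] -/
theorem hull_iff_edgeForm {Λ : Finset HexVertex} {a : Sym2 HexVertex} {H : Site 2 → ℂ}
    (hH : IsPotential Λ a H) {s : Site 2} (hs : IsInteriorSite Λ s) (d : ℂ) :
    (∃ t ∈ siteNbrs s, 0 < ((starRingEnd ℂ) d * (H t - H s)).re) ↔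
      ∃ k : Fin 6, 0 < ((starRingEnd ℂ) d *
        edgeValue (hexParafermionicObservable Λ a hexCriticalFugacity (5 / 8)) s k).re := by
  constructor
  · rintro ⟨t, ht, hpos⟩
    obtain ⟨k, rfl⟩ := exists_spoke_eq_of_mem_siteNbrs ht
    exact ⟨k, by rw [← potential_spoke hH hs k]; exact hpos⟩
  · rintro ⟨k, hpos⟩
    exact ⟨spoke s k, spoke_mem_siteNbrs s k, by rw [potential_spoke hH hs k]; exact hpos⟩

/-! ### The discrete minimum principle -/

/-- **Discrete minimum principle (registered sub-goal `hull_minPrinciple` of crux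
stmt-CriticalPhenomena-14004).**  If at every interior site of `Λ` the six neighbour increments of
`H` lie in no closed half-plane (for every `d ≠ 0` some increment has positive real part against
`conj d`), then for every direction `d ≠ 0` the linear functional `s ↦ Re(conj d · H s)` attains
its minimum over the (finitely many) sites of `Λ` at a BOUNDARY site: for every site `s₀` of `Λ`
there is a non-interior site `s` of `Λ` with `Re(conj d · H s) ≤ Re(conj d · H s₀)`. [folklore] -/
theorem hull_minPrinciple {Λ : Finset HexVertex} {H : Site 2 → ℂ}
    (hHull : ∀ s : Site 2, IsInteriorSite Λ s → ∀ d : ℂ, d ≠ 0 →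
      ∃ t ∈ siteNbrs s, 0 < ((starRingEnd ℂ) d * (H t - H s)).re)
    {d : ℂ} (hd : d ≠ 0) {s₀ : Site 2} (hs₀ : IsLatticeSite Λ s₀) :
    ∃ s : Site 2, IsLatticeSite Λ s ∧ ¬ IsInteriorSite Λ s ∧
      ((starRingEnd ℂ) d * H s).re ≤ ((starRingEnd ℂ) d * H s₀).re := by
  classical
  set S : Finset (Site 2) := Λ.biUnion fun f => hexFaceVertices f with hS
  have hmemS : ∀ t : Site 2, t ∈ S ↔ IsLatticeSite Λ t := fun t => by
    simp only [hS, Finset.mem_biUnion, IsLatticeSite]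
  have hs₀S : s₀ ∈ S := (hmemS s₀).2 hs₀
  obtain ⟨s, hsS, hmin⟩ := S.exists_min_image (fun t => ((starRingEnd ℂ) d * H t).re) ⟨s₀, hs₀S⟩
  refine ⟨s, (hmemS s).1 hsS, fun hint => ?_, hmin s₀ hs₀S⟩
  obtain ⟨t, ht, hpos⟩ := hHull s hint (-d) (neg_ne_zero.2 hd)
  have htS : t ∈ S := (hmemS t).2 (isLatticeSite_of_mem_siteNbrs hint ht)
  have hle := hmin t htS
  rw [map_neg, neg_mul, Complex.neg_re, mul_sub, Complex.sub_re] at hpos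
  linarith

/-- **Registered sub-goal `stub_halfPlaneInputs_minPrinciple`** of crux stmt-CriticalPhenomena-14004
(line pick-half-plane, serving `stub_halfPlaneInputs`): the discrete minimum principle in
registry form (one `∀`-term; see `hull_minPrinciple`). [folklore] -/
theorem stub_halfPlaneInputs_minPrinciple : ∀ (Λ : Finset HexVertex) (H : Site 2 → ℂ), (∀ s : Site 2, IsInteriorSite Λ s → ∀ d : ℂ, d ≠ 0 → ∃ t ∈ siteNbrs s, 0 < ((starRingEnd ℂ) d * (H t - H s)).re) → ∀ (d : ℂ), d ≠ 0 → ∀ (s₀ : Site 2), IsLatticeSite Λ s₀ → ∃ s : Site 2, IsLatticeSite Λ s ∧ ¬ IsInteriorSite Λ s ∧ ((starRingEnd ℂ) d * H s).re ≤ ((starRingEnd ℂ) d * H s₀).re :=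
  fun _ _ hHull _ hd _ hs₀ => hull_minPrinciple hHull hd hs₀

/-- The minimum principle in edge-value form: hypothesis = the strict hexagon hull condition on the
six rotated edge values of the critical observable at every full hexagon of `Λ` (the shape of the
card `hexagon-hull-tutte-engine`'s `HexHullCondition`, crux stmt-8296). [folklore] -/
theorem hull_minPrinciple_edgeForm {Λ : Finset HexVertex} {a : Sym2 HexVertex} {H : Site 2 → ℂ}
    (hH : IsPotential Λ a H)
    (hHull : ∀ s : Site 2, IsInteriorSite Λ s → ∀ d : ℂ, d ≠ 0 → ∃ k : Fin 6,
      0 < ((starRingEnd ℂ) d *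
        edgeValue (hexParafermionicObservable Λ a hexCriticalFugacity (5 / 8)) s k).re)
    {d : ℂ} (hd : d ≠ 0) {s₀ : Site 2} (hs₀ : IsLatticeSite Λ s₀) :
    ∃ s : Site 2, IsLatticeSite Λ s ∧ ¬ IsInteriorSite Λ s ∧
      ((starRingEnd ℂ) d * H s).re ≤ ((starRingEnd ℂ) d * H s₀).re :=
  hull_minPrinciple (fun s hs d' hd' => (hull_iff_edgeForm hH hs d').2 (hHull s hs d' hd')) hd hs₀

/-! ### The flux polygon -/

/-- **The flux polygon.**  If `F` satisfies the vertex relation at the hexagon vertex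
`face s (k+1)`, consecutive rotated edge values differ by the RADIAL term there:
`edgeValue (k+1) − edgeValue k = (mid(f_{k+1}) − c(face_{k+1}))·F(f_{k+1})`, `f_{k+1}` the edge
to `outFace s (k+1)`.  So the six rotated edge values are the vertices of a closed polygon whose
edge vectors are the six outward fluxes; its position (the hexagon circulation `Σ_k edgeValue k`)
is the coefficient of the kernel element `HexKernel.witness s`, invisible to the relations — the
strict hull condition says the origin lies strictly inside this polygon. [folklore] -/
theorem edgeValue_succ_sub {Λ : Finset HexVertex} {F : Sym2 HexVertex → ℂ}
    (hF : SatisfiesVertexRelations Λ F) (s : Site 2) (k : Fin 6)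
    (hv : HexKernel.face s (k + 1) ∈ Λ) :
    edgeValue F s (k + 1) - edgeValue F s k =
      HexKernel.term F (HexKernel.face s (k + 1)) (HexKernel.outFace s (k + 1)) := by
  have h0 := HexKernel.hexGraph_adj_iff_of_snd_eq_zero_holds
  have h2 := HexKernel.not_hexGraph_adj_of_snd_eq_holds
  have hadj := fun w => HexKernel.adj_face_iff h0 h2 s k w
  have hp : hexGraph.Adj (HexKernel.face s (k + 1)) (HexKernel.face s k) := (hadj _).2 (Or.inl rfl)
  have hq : hexGraph.Adj (HexKernel.face s (k + 1)) (HexKernel.face s (k + 1 + 1)) :=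
    (hadj _).2 (Or.inr (Or.inl rfl))
  have hr : hexGraph.Adj (HexKernel.face s (k + 1)) (HexKernel.outFace s (k + 1)) :=
    (hadj _).2 (Or.inr (Or.inr rfl))
  have hpq : HexKernel.face s k ≠ HexKernel.face s (k + 1 + 1) := by
    rw [Ne, HexKernel.face_inj]; fin_cases k <;> decide
  have hqr : HexKernel.face s (k + 1 + 1) ≠ HexKernel.outFace s (k + 1) :=
    fun h => HexKernel.outFace_ne_face s (k + 1) (k + 1 + 1) h.symm
  have hpr : HexKernel.face s k ≠ HexKernel.outFace s (k + 1) :=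
    fun h => HexKernel.outFace_ne_face s (k + 1) k h.symm
  have key := hF (HexKernel.face s (k + 1)) hv _ _ _ hp hq hr hpq hqr hpr
  have e1 : s(HexKernel.face s (k + 1), HexKernel.face s k) = HexKernel.edge s k := by
    rw [HexKernel.edge, Sym2.eq_swap]
  have e2 : s(HexKernel.face s (k + 1), HexKernel.face s (k + 1 + 1)) = HexKernel.edge s (k + 1) := rfl
  have hmid : hexMidpoint (HexKernel.edge s (k + 1)) - hexCenter (HexKernel.face s (k + 1 + 1)) =
      -(hexMidpoint (HexKernel.edge s (k + 1)) - hexCenter (HexKernel.face s (k + 1))) := by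
    rw [HexKernel.edge, hexMidpoint_mk]; ring
  simp only [edgeValue, HexKernel.term]
  rw [hmid, ← e1, ← e2]
  rw [e1] at key ⊢
  linear_combination -key

/-- **Closedness around a hexagon**: the six radial terms at the vertices of a full hexagon sum
to zero — the flux polygon closes up. [folklore] -/
theorem sum_radial_term_eq_zero {Λ : Finset HexVertex} {F : Sym2 HexVertex → ℂ}
    (hF : SatisfiesVertexRelations Λ F) (s : Site 2)
    (hv : ∀ k : Fin 6, HexKernel.face s k ∈ Λ) :
    ∑ k : Fin 6, HexKernel.term F (HexKernel.face s (k + 1)) (HexKernel.outFace s (k + 1)) = 0 := by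
  have h := fun k : Fin 6 => edgeValue_succ_sub hF s k (hv (k + 1))
  simp only [← h, Fin.sum_univ_six]
  simp only [Fin.isValue, show (1 : Fin 6) + 1 = 2 from rfl, show (2 : Fin 6) + 1 = 3 from rfl,
    show (3 : Fin 6) + 1 = 4 from rfl, show (4 : Fin 6) + 1 = 5 from rfl,
    show (5 : Fin 6) + 1 = 0 from rfl, zero_add]
  ring

end Summit.CriticalPhenomena.SAWScalingLimit.Theorems.PickHalfPlane

end
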